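import Literature.NumberTheory.EllipticCurves.ComplexMultiplicationHasCMTwoLeavesProofs
import Literature.NumberTheory.EllipticCurves.ComplexMultiplicationHasCMHeegnerStarkProofs
import Literature.NumberTheory.EllipticCurves.ComplexMultiplicationLFunctionTableProofs
import Literature.NumberTheory.QuadraticFields.ClassNumberOneLandauProofs
import HarnessLib

/-!
# `bsdRankFormula_of_hasCM_of_L_one_ne_zero` rests on the Coates–Wiles core alone

Topic `NumberTheory/EllipticCurves`; proofs-only sibling (theorems only: no definition, no named
fact, no instance) of `ComplexMultiplication.lean` for the named facts
`Literature.NumberTheory.EllipticCurves.bsdRankFormula_of_hasCM_of_L_one_ne_zero` and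
`Literature.NumberTheory.EllipticCurves.finite_point_of_hasCM_of_L_one_ne_zero` (bsd.S28, the
Mordell–Weil part of the Birch–Swinnerton-Dyer conjecture for `E/ℚ` with complex multiplication:
`L(E, 1) ≠ 0 ⟹ E(ℚ)` finite, hence `r_an(E) = rank E(ℚ) = 0`; J. Coates, A. Wiles, *On the
conjecture of Birch and Swinnerton-Dyer*, Invent. Math. **39** (1977), Thm. 1, p. 223, with the
isogeny reduction to complex multiplication by a maximal order).

The two-leaf assembly `bsdRankFormula_of_hasCM_of_L_one_ne_zero_of_two_leaves (h1 hh)`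
(`ComplexMultiplicationHasCMTwoLeavesProofs.lean`) took

* `h1 = CoatesWiles1977_L_one_div_period_mem_prime` — the `𝔭`-adic core of Coates–Wiles (§6,
  p. 250: a rational point of infinite order forces `𝔭 ∣ Ω⁻¹ L(E/ℚ, 1)` for every good, split,
  non-anomalous `p > 7`), and
* `hh = mem_classNumberOneDiscrs_of_classNumber_eq_one` — the class number one theorem for
  imaginary quadratic orders (Heegner–Stark–Baker; Cox, *Primes of the form x² + ny²*,
  Thm. 7.30(ii)).

The second leaf is now a theorem of the tree,
`Literature.NumberTheory.QuadraticFields.BinaryQuadraticForm.mem_classNumberOneDiscrs_of_classNumber_eq_one_holds`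
(`QuadraticFields/ClassNumberOneLandauProofs.lean`, by Baker's route, *Transcendental Number
Theory* Ch. 5 §4), and with it the classification of rational CM `j`-invariants
(`j_mem_cmJInvariants_of_hasCM_holds`, `ComplexMultiplicationHasCMIffHoldsProofs.lean`). This file
records the resulting exact trust base of the two bsd.S28 facts — **one** named fact, in either
of the two equivalent forms in which the tree states the deep input of Coates–Wiles:

* `finite_point_of_hasCM_of_L_one_ne_zero_of_one_leaf`,
  `bsdRankFormula_of_hasCM_of_L_one_ne_zero_of_one_leaf` — from the per-prime core
  `CoatesWiles1977_L_one_div_period_mem_prime` (CW §6 p. 250);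
* `finite_point_of_hasCM_of_L_one_ne_zero_of_CoatesWiles1977_thm1`,
  `bsdRankFormula_of_hasCM_of_L_one_ne_zero_of_CoatesWiles1977_thm1` — from Theorem 1 for
  `F = ℚ` as printed, `CoatesWiles1977_L_one_eq_zero_of_not_isOfFinAddOrder` (CW p. 223).

(The two forms are equivalent over the tree:
`CoatesWiles1977_L_one_eq_zero_of_not_isOfFinAddOrder_of_mem_prime_of_singularModuli h1
singularModuli_classNumberOne_holds` and
`CoatesWiles1977_L_one_div_period_mem_prime_of_L_one_eq_zero`,
`ComplexMultiplicationCoatesWilesGrossZagierProofs.lean`.) The discharge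
`bsdRankFormula_of_hasCM_of_L_one_ne_zero_holds` is therefore the one-liner
`bsdRankFormula_of_hasCM_of_L_one_ne_zero_of_one_leaf CoatesWiles1977_L_one_div_period_mem_prime_holds`
as soon as that theorem exists. Net debt delta `0`: nothing is stated here.

## References

* [CoatesWiles1977] J. Coates, A. Wiles, *On the conjecture of Birch and Swinnerton-Dyer*,
  Invent. Math. 39 (1977), 223–251: Thm. 1 (p. 223); §6, proof of Thm. 1 (pp. 250–251).
* [Cox2013] D. A. Cox, *Primes of the form x² + ny²*, 2nd ed., Wiley (2013): Thm. 7.30(ii),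
  Thm. 12.34.
* [SilvermanAEC2009] J. H. Silverman, *The Arithmetic of Elliptic Curves*, 2nd ed., GTM 106
  (2009): App. C §11, Examples 11.3.1–11.3.2; App. C §16.
-/

namespace Literature.NumberTheory.EllipticCurves

open Literature.NumberTheory.QuadraticFields.BinaryQuadraticForm

/-! ### From the per-prime core of Coates–Wiles (§6, p. 250) -/

/-- **bsd.S28, Mordell–Weil part, from the Coates–Wiles core alone.** If
`CoatesWiles1977_L_one_div_period_mem_prime` holds (Coates–Wiles 1977, §6 p. 250: a rational point
of infinite order on `E/ℚ` with `j(E) ∈ maximalCMJInvariants` forces `𝔭 ∣ Ω⁻¹L(E/ℚ, 1)` for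
every good, split, non-anomalous prime `p > 7`, `𝔭 ∣ p`), then every elliptic curve `E/ℚ` with
(geometric) complex multiplication and `L(E, 1) ≠ 0` has `E(ℚ)` finite. The class number one
leaf of `finite_point_of_hasCM_of_L_one_ne_zero_of_two_leaves` is discharged by
`mem_classNumberOneDiscrs_of_classNumber_eq_one_holds`.
[cite: CoatesWiles1977, Thm 1 (p. 223) and §6 p. 250] -/
theorem finite_point_of_hasCM_of_L_one_ne_zero_of_one_leaf
    (h1 : CoatesWiles1977_L_one_div_period_mem_prime) :
    finite_point_of_hasCM_of_L_one_ne_zero :=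
  finite_point_of_hasCM_of_L_one_ne_zero_of_two_leaves h1
    mem_classNumberOneDiscrs_of_classNumber_eq_one_holds

/-- **The BSD rank formula in the CM analytic-rank-zero case, from the Coates–Wiles core alone**:
under `CoatesWiles1977_L_one_div_period_mem_prime`, every elliptic curve `E/ℚ` with complex
multiplication and `L(E, 1) ≠ 0` satisfies `r_an(E) = rank E(ℚ)` (`= 0`). This is the exact
trust base of the named fact `bsdRankFormula_of_hasCM_of_L_one_ne_zero` over the tree.
[cite: CoatesWiles1977, Thm 1 (rank-zero consequence)] -/
theorem bsdRankFormula_of_hasCM_of_L_one_ne_zero_of_one_leaf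
    (h1 : CoatesWiles1977_L_one_div_period_mem_prime) :
    bsdRankFormula_of_hasCM_of_L_one_ne_zero :=
  bsdRankFormula_of_hasCM_of_L_one_ne_zero_of_two_leaves h1
    mem_classNumberOneDiscrs_of_classNumber_eq_one_holds

/-! ### From Theorem 1 of Coates–Wiles for `F = ℚ` as printed (p. 223) -/

/-- **bsd.S28, Mordell–Weil part, from Coates–Wiles' Theorem 1 (`F = ℚ`) alone**: if a rational
point of infinite order on `E/ℚ` with `j(E) ∈ maximalCMJInvariants` forces `L(E/ℚ, 1) = 0`
(`CoatesWiles1977_L_one_eq_zero_of_not_isOfFinAddOrder`, Thm. 1 p. 223 for `F = ℚ`), then every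
elliptic curve `E/ℚ` with complex multiplication and `L(E, 1) ≠ 0` has `E(ℚ)` finite; the
classification leaf `j_mem_cmJInvariants_of_hasCM` of
`finite_point_of_hasCM_of_L_one_ne_zero_of_CoatesWiles1977_of_j_mem_cmJInvariants_of_hasCM` is
discharged by `j_mem_cmJInvariants_of_hasCM_of_heegnerStarkPrime HeegnerStarkPrimeThreeModEight_holds`
(`= j_mem_cmJInvariants_of_hasCM_holds` of `ComplexMultiplicationHasCMIffHoldsProofs.lean`).
[cite: CoatesWiles1977, Thm 1 (p. 223)] -/
theorem finite_point_of_hasCM_of_L_one_ne_zero_of_CoatesWiles1977_thm1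
    (hCW : CoatesWiles1977_L_one_eq_zero_of_not_isOfFinAddOrder) :
    finite_point_of_hasCM_of_L_one_ne_zero :=
  finite_point_of_hasCM_of_L_one_ne_zero_of_CoatesWiles1977_of_j_mem_cmJInvariants_of_hasCM hCW
    (j_mem_cmJInvariants_of_hasCM_of_heegnerStarkPrime HeegnerStarkPrimeThreeModEight_holds)

/-- **The BSD rank formula in the CM analytic-rank-zero case from Coates–Wiles' Theorem 1
(`F = ℚ`) alone**: `r_an(E) = rank E(ℚ)` (`= 0`) for every elliptic curve `E/ℚ` with complex
multiplication and `L(E, 1) ≠ 0`. [cite: CoatesWiles1977, Thm 1 (rank-zero consequence)] -/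
theorem bsdRankFormula_of_hasCM_of_L_one_ne_zero_of_CoatesWiles1977_thm1
    (hCW : CoatesWiles1977_L_one_eq_zero_of_not_isOfFinAddOrder) :
    bsdRankFormula_of_hasCM_of_L_one_ne_zero :=
  bsdRankFormula_of_hasCM_of_L_one_ne_zero_of_CoatesWiles1977_of_j_mem_cmJInvariants_of_hasCM hCW
    (j_mem_cmJInvariants_of_hasCM_of_heegnerStarkPrime HeegnerStarkPrimeThreeModEight_holds)

end Literature.NumberTheory.EllipticCurves
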